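import Mathlib
import HarnessLib
import Summits.Langlands.Langlands.Theses.SenNullAlignment
import Literature.NumberTheory.PAdicHodge.SenOperator
import Literature.NumberTheory.Automorphic.SpecialRepresentationGL2

/-!
# Birth skeleton (BC3) for crux stmt-Langlands-16360
`Summit.Langlands.Langlands.Theses.SenNullAlignment.AlignedAtEll` — line `birth`

Route `route-Langlands-SenNullAlignment` (rank-4 crux).  The crux: `K` totally real, `RD` reciprocity data
serving the regular Hilbert case, `π` cuspidal on `GL₂(𝔸_K)`, L-algebraic, holomorphic of weight `(k, w)`
with some `k_β = 1`, totally odd; `ℓ`, `ι`, `ρ : Γ_K → GL₂(ℚ̄_ℓ)` irreducible and Satake–Frobenius compatible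
with `π` at almost all places; `v ∣ ℓ` FULLY ALIGNED (every `ℓ`-adic embedding inducing `v` reads weight one)
and the image of every inertia group above `v` under `ρ` FINITE MODULO SCALARS (the output of the route's
lever `SingularProjectiveFinite`).  Conclusion: `LocalGlobalCompatibleAt RD ι π ρ v ∧` de Rham at `v` for
Fontaine's pinned datum `RD.pst ℓ v hv`.

The skeleton is the route's own foreseen two-layer plan for this node ("AlignedAtEll ⇐ NoSpecialAligned →
TypeMatchingAligned", route header, TWO-LAYER PLAN), now typeable because the two definition requests of the
route have landed (`FramedGaloisRep.IsHodgeTateAt` / Sen's operator, `PAdicHodge.SenOperator`;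
`AutomorphicRepData.IsSpecialAt`, `SpecialRepresentationGL2`), cut along the crux's own description of its
content ("`ρ|Γ_v ≅ χ ⊗ ρ₀` with `ρ₀` potentially unramified, so de Rham ⇔ `χ` Hodge–Tate; WD matching = Galois
type of `ρ₀` versus inertial type of `π_v` and Frobenius versus `U_v`; it FORCES `π_v` non-special"):

* `stub_hodgeTateAtAligned` — **automorphic ⇒ Galois, the `p`-adic Hodge input** (L–XL): in the crux's
  setting (no `RD` needed) `ρ` is Hodge–Tate at `(v, τ)` for every `τ : K_v →+* ℚ̄_ℓ` (`Θ_τ(ρ|Γ_{K_v})`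
  semisimple with integer eigenvalues).  On paper: `ρ ≅ ρ_{π,ι}` (Chebotarev + Brauer–Nesbitt, `ρ`
  irreducible), the generalized `τ`-Hodge–Tate weights of `ρ_{π,ι}` are the integers `{m_τ, m_τ}` at the
  weight-one `τ` (Boxer–Pilloni Thm. 23 (3)), and `Θ_τ` is SCALAR because inertia acts through scalars times
  a finite group (`ρ|Γ_L = χ ⊗ ρ_L`, `ρ_L` unramified, over a finite `L/K_v`; `Θ(χ ⊗ ρ_L) = Θ(χ) ⊗ 1`).
* `stub_deRhamOfProjFiniteHodgeTate` — **pure local `p`-adic Hodge theory, in print** (L): for ANY number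
  field `K`, any `n`, any `ρ : Γ_K → GL_n(ℚ̄_ℓ)` and `v ∣ ℓ`: inertia above `v` finite modulo scalars and `ρ`
  Hodge–Tate at every `(v, τ)` ⇒ `ρ|Γ_{K_v}` de Rham for Fontaine's pinned datum.  (Potentially
  `ρ = χ ⊗` unramified; a Hodge–Tate character is locally algebraic (Tate, Serre III), hence de Rham;
  unramified ⇒ crystalline; de Rham is insensitive to finite base change and stable under `⊗`.)
* `stub_notSpecialAtAligned` — **the route's falsifiable prediction, the open automorphic content** (XL):
  in the crux's setting `π` is NOT special at `v` (`¬ π.1.IsSpecialAt v`: no local component at `v` is a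
  twist of Steinberg).  It is what local–global compatibility at `v` would give (`N_Gal = 0` by projective
  finiteness versus `N(rec(St ⊗ χ)) ≠ 0`) and exactly the "automorphic contradiction nobody has derived" of
  the crux's why-might-fail; refutable by ONE partial-weight-one newform Steinberg at an aligned place.
* `stub_lgcOfNotSpecialAligned` — **Weil–Deligne matching at an aligned non-special place** (XL): in the
  crux's full setting, GIVEN de Rham at `v` and `π` not special at `v`, `LocalGlobalCompatibleAt RD ι π ρ v`
  (inertial type of `ρ₀` versus that of `π_v`, Frobenius versus `U_v`): Boxer–Pilloni Thm. 23 (4) for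
  regular principal series (Kisin's crystalline periods on the eigenvariety), solvable totally real base
  change killing the type + Brauer induction on the Weil side for the rest; `ℓ = 2` supercuspidals and
  weight-one companion points are where it may fail.
* `AlignedAtEll_of` — **the composition, kernel-checked**: Hodge–Tate (stub 1) and projective finiteness
  give de Rham (stub 2, at `n = 2`; `RD.pst ℓ v hv` is by definition Fontaine's pinned
  `fontainePstAdicCompletion v ℓ hv`), non-speciality (stub 3) feeds stub 4 for the compatibility clause.
  Concludes the route decl BY NAME.

Honest reading of the cut: stubs 1–2 carry the Galois/`p`-adic Hodge half (1 = automorphic input + Sen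
operator of a twist, 2 = a theorem in print over the tree's pinned Sen operator and Fontaine datum), stubs
3–4 the automorphic half (3 = the open special-at-aligned exclusion, 4 = type/Frobenius matching for
principal series and supercuspidals).  No stub is the crux or the summit: 1 and 3 conclude statements the
crux does not mention, 2 is `RD`/`π`-free and ranges over all number fields and ranks, 4 needs the two extra
hypotheses that 2 and 3 produce.

Disproof used: none on file for this crux (`ledger crux ls stmt-Langlands-16360`: no workfiles, no
`Disproof.lean`, no `Negative/` lemmas, no dead lines, 2026-08-17); `ledger negatives --problem Langlands`
(3 entries: SplitPrimeInduction, OrdinaryPrimeTransport, K3KugaSatakeDescent) — none bears on these stubs.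

Shape (for `ledger skeleton check`): stubs `theorem stub_<name> : <signature> := by sorry` stated over tree
declarations only; `_Goal.stub_<name> : Prop := type_of% @stub_<name>` names each statement; the composition
`AlignedAtEll_of (h1 : _Goal.stub_hodgeTateAtAligned) (h2 : _Goal.stub_deRhamOfProjFiniteHodgeTate)
(h3 : _Goal.stub_notSpecialAtAligned) (h4 : _Goal.stub_lgcOfNotSpecialAligned) : AlignedAtEll` is proved
without `sorry`.
-/

set_option linter.dupNamespace false
set_option linter.unusedVariables false

noncomputable section

namespace Summit.Langlands.Langlands.Cruxes.AlignedAtEll.Birth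

open Summit.Langlands.Langlands.Theses.SenNullAlignment
open Literature.NumberTheory.GaloisRepresentations Literature.NumberTheory.Automorphic
open Literature.NumberTheory.PAdicHodge
-- the route file's scopes (the crux signature elaborates under `open scoped Classical`: `MonoidHom.mulSingle`
-- at an infinite place needs `DecidableEq (NumberField.InfinitePlace K)`)
open scoped BigOperators Topology Manifold Classical MeasureTheory ProbabilityTheory Matrix InnerProductSpace ComplexConjugate ContinuousMap

/-! ## 1. The four stubs -/

/-- **STUB 1 — Hodge–Tate at a fully aligned place with projectively finite inertia (automorphic ⇒ Galois).**
`K` totally real; `π` cuspidal on `GL₂(𝔸_K)`, L-algebraic, holomorphic of weight `(k, w)` (the inlined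
weight-`(k, w)` infinity type of the route), totally odd, with some `k_β = 1`; `ℓ`, `ι`; `ρ : Γ_K → GL₂(ℚ̄_ℓ)`
irreducible and Satake–Frobenius compatible with `π` at almost all `v`; `v ∣ ℓ` fully aligned
(`k (ι ∘ τ) = 1` for every `τ : K → ℚ̄_ℓ` inducing `v`) and the image of every inertia group above `v` finite
modulo scalars.  THEN `ρ` is Hodge–Tate at `(v, τ)` for every `τ : K_v →+* ℚ̄_ℓ`, for the canonical
`ℚ_ℓ`-structure of `K_v`: Sen's operator `Θ_τ(ρ|Γ_{K_v})` is semisimple with integer eigenvalues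
(`FramedGaloisRep.IsHodgeTateAt`).  Why plausibly true: `ρ ≅ ρ_{π,ι}` (Chebotarev density + Brauer–Nesbitt,
both irreducible with the same Frobenius traces a.e.); the generalized `ι⁻¹ ∘ τ`-Hodge–Tate weights of
`ρ_{π,ι}` are read off the infinitesimal character (Boxer–Pilloni Thm. 23 (3)) and at a weight-one `τ` they
COINCIDE, `{m_τ, m_τ}` with `m_τ = -w/2 ∈ ℤ` (L-algebraic); and projective finiteness of inertia makes
`Θ_τ` a SCALAR: over a finite `L/K_v` trivialising the projective image of inertia, `ρ|Γ_L = χ ⊗ ρ_L` with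
`ρ_L` unramified (lift a compact lift of Frobenius), so `Θ(ρ|Γ_L) = Θ(χ) ⊗ 1` and Sen's operator is
insensitive to finite restriction.  Why it might fail: the identification `ρ ≅ ρ_{π,ι}` in the tree's
L-normalisation (a twist slip shifts the weights off `{m, m}` but keeps them integral — harmless) and the
junk value of the pinned `senOperator` where `SenOperatorExistsUnique` is not yet discharged.  Size L–XL.
[cite: BoxerPilloni2021HigherColeman, Thm. 23 (3)] [cite: BrinonConrad2009, Thm. 15.1.7 and Cor. 15.1.10]
[cite: Jarvis1997, Thm. 1] [cite: Patrikis2019, §2 (lifting projective representations)] -/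
theorem stub_hodgeTateAtAligned :
    ∀ (K : Type) [Field K] [NumberField K], NumberField.IsTotallyReal K → ∀ (hcpt : Literature.NumberTheory.Automorphic.isCompact_glFiniteIntegralLevel 2 K) (π : Literature.NumberTheory.Automorphic.CuspidalAutomorphicRepData 2 K hcpt) (k : (K →+* ℂ) → ℕ) (w : ℤ), π.1.IsLAlgebraic → π.1.HasInfinityType (fun β : K →+* ℂ => ({(⟨((k β : ℂ) - 1 - w) / 2, (1 - (k β : ℂ) - w) / 2, (k β : ℤ) - 1, by push_cast; ring⟩ : Literature.NumberTheory.Automorphic.ArchWeight), (⟨((k β : ℂ) - 1 - w) / 2, (1 - (k β : ℂ) - w) / 2, (k β : ℤ) - 1, by push_cast; ring⟩ : Literature.NumberTheory.Automorphic.ArchWeight).swap} : Multiset Literature.NumberTheory.Automorphic.ArchWeight)) → (∀ (u : NumberField.InfinitePlace K), ∀ φ ∈ π.1.W, Literature.NumberTheory.Automorphic.rightTranslation (Literature.NumberTheory.Automorphic.AdelicGroupData.gl 2 K) (Matrix.GeneralLinearGroup.scalar (Fin 2) (Units.map (MonoidHom.inl (NumberField.InfiniteAdeleRing K) (IsDedekindDomain.FiniteAdeleRing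 (NumberField.RingOfIntegers K) K) : NumberField.InfiniteAdeleRing K →* NumberField.AdeleRing (NumberField.RingOfIntegers K) K) (Units.map (MonoidHom.mulSingle (fun u' : NumberField.InfinitePlace K => u'.Completion) u : u.Completion →* NumberField.InfiniteAdeleRing K) (-1)))) φ + φ ∈ π.1.W') → (∃ β : K →+* ℂ, k β = 1) → ∀ (ℓ : ℕ) [Fact ℓ.Prime] (ι : PadicAlgCl ℓ ≃+* ℂ) (ρ : Literature.NumberTheory.GaloisRepresentations.FramedGaloisRep K (PadicAlgCl ℓ) 2), ρ.toGaloisRep.IsIrreducible → (∀ᶠ v : IsDedekindDomain.HeightOneSpectrum (NumberField.RingOfIntegers K) in Filter.cofinite, Summit.Langlands.SatakeFrobCompatibleAt ι π.1 ρ v) → ∀ (v : IsDedekindDomain.HeightOneSpectrum (NumberField.RingOfIntegers K)) (hv : ((ℓ : ℕ) : NumberField.RingOfIntegers K) ∈ v.asIdeal), (∀ τ : K →+* PadicAlgCl ℓ, (∀ x : NumberField.RingOfIntegers K, x ∈ v.asIdeal → ‖τ x‖ < 1) → k ((ι : PadicAlgCl ℓ →+* ℂ).comp τ) = 1) → (∀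 𝔓 ∈ v.primesAbove, ∃ S : Finset (GL (Fin 2) (PadicAlgCl ℓ)), ∀ σ ∈ 𝔓.inertia (Field.absoluteGaloisGroup K), ∃ g ∈ S, ∃ c : PadicAlgCl ℓ, ((ρ σ : GL (Fin 2) (PadicAlgCl ℓ)) : Matrix (Fin 2) (Fin 2) (PadicAlgCl ℓ)) = c • ((g : GL (Fin 2) (PadicAlgCl ℓ)) : Matrix (Fin 2) (Fin 2) (PadicAlgCl ℓ))) → ∀ τ : v.adicCompletion K →+* PadicAlgCl ℓ, ρ.IsHodgeTateAt v (Literature.NumberTheory.GaloisRepresentations.LocalField.adicCompletionPadicAlgebra v ℓ hv) τ := by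
  sorry

/-- **STUB 2 — projectively finite inertia + Hodge–Tate ⇒ de Rham (pure local `p`-adic Hodge theory).**
For ANY number field `K`, rank `n`, `ρ : Γ_K → GL_n(ℚ̄_ℓ)` and place `v ∣ ℓ`: if the image of every inertia
group above `v` under `ρ` is finite modulo scalars and `ρ` is Hodge–Tate at `(v, τ)` for every
`τ : K_v →+* ℚ̄_ℓ` (canonical `ℚ_ℓ`-structure `LocalField.adicCompletionPadicAlgebra v ℓ hv`), then
`ρ|Γ_{K_v}` is de Rham for Fontaine's pinned datum `fontainePstAdicCompletion v ℓ hv` (the term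
`RD.pst ℓ v hv` of the summit denotes, by definition).  Why plausibly true (a theorem in print): over a
finite `L/K_v` on whose inertia the projective image dies, `ρ|Γ_L = χ ⊗ ρ_L` with `ρ_L : Γ_L → GL_n(ℚ̄_ℓ)`
unramified (the unramified projective representation lifts through a compact lift of Frobenius; two lifts
differ by a character); `ρ_L` is Hodge–Tate of weights `0` (Sen: `Θ = 0` iff finite inertia image), so
`χ ⊂ (χ ⊗ ρ_L) ⊗ ρ_L^∨` is Hodge–Tate; a Hodge–Tate CHARACTER is locally algebraic (Tate's theorem,
Serre III.A7), hence de Rham; `ρ_L` unramified is crystalline; de Rham is stable under `⊗` and insensitive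
to finite base change (Fontaine, Exp. III).  Why it might fail: only through the pinned-by-specification
carriers (`senOperator` under `SenOperatorExistsUnique`, `fontainePst` under `FontaineDatumExists`) whose
`ℚ_ℓ`-structures agree (`fontainePstAdicCompletion_algebra`).  Size L.
[cite: Sen1973, main theorem (Θ = 0 iff potentially unramified; not consulted, via BergerLaurent2004Introduction §1–§2)]
[cite: SerreAbelianLadic1968, Ch. III §1 and Appendix A7 (Tate: abelian Hodge–Tate ⇒ locally algebraic)]
[cite: FontaineAsterisque223III, Exp. III §1.5 and §3] [cite: BrinonConrad2009, Exercise 15.5.4 and Thm. 2.2.7] -/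
theorem stub_deRhamOfProjFiniteHodgeTate :
    ∀ (K : Type) [Field K] [NumberField K] (n : ℕ) (ℓ : ℕ) [Fact ℓ.Prime] (ρ : Literature.NumberTheory.GaloisRepresentations.FramedGaloisRep K (PadicAlgCl ℓ) n) (v : IsDedekindDomain.HeightOneSpectrum (NumberField.RingOfIntegers K)) (hv : ((ℓ : ℕ) : NumberField.RingOfIntegers K) ∈ v.asIdeal), (∀ 𝔓 ∈ v.primesAbove, ∃ S : Finset (GL (Fin n) (PadicAlgCl ℓ)), ∀ σ ∈ 𝔓.inertia (Field.absoluteGaloisGroup K), ∃ g ∈ S, ∃ c : PadicAlgCl ℓ, ((ρ σ : GL (Fin n) (PadicAlgCl ℓ)) : Matrix (Fin n) (Fin n) (PadicAlgCl ℓ)) = c • ((g : GL (Fin n) (PadicAlgCl ℓ)) : Matrix (Fin n) (Fin n) (PadicAlgCl ℓ))) → (∀ τ : v.adicCompletion K →+* PadicAlgCl ℓ, ρ.IsHodgeTateAt v (Literature.NumberTheory.GaloisRepresentations.LocalField.adicCompletionPadicAlgebra v ℓ hv) τ) → (Literature.NumberTheory.PAdicHodge.fontainePstAdicCompletion v ℓ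 hv).IsDeRhamFramed (ρ.toLocal v) := by
  sorry

/-- **STUB 3 — no special component at a fully aligned place (the route's falsifiable prediction; OPEN).**
In the setting of stub 1 (`K` totally real; `π` L-algebraic cuspidal, holomorphic of weight `(k, w)`, totally
odd, some `k_β = 1`; `ρ` irreducible, Satake–Frobenius compatible a.e.; `v ∣ ℓ` fully aligned; inertia
above `v` finite modulo scalars under `ρ`), `π` is NOT special at `v`: no irreducible smooth local component
of `π` at `v` is a twist `St ⊗ (χ ∘ det)` of the Steinberg representation (`¬ π.1.IsSpecialAt v`, the
landed definition request D2 of the route).  Why plausibly true: it is what local–global compatibility at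
`v` predicts — `ρ|Γ_{K_v}` is a twist of a potentially unramified representation, so `WD(ρ|Γ_{K_v})` has
`N = 0`, whereas `rec_v(St ⊗ χ) = Sp(2) ⊗ χ` has `N ≠ 0`; equivalently (weak admissibility) a semistable
non-crystalline rank-2 filtered module needs `Σ_{τ ∣ v} (k_τ - 1) ≥ f_v`, impossible when all `k_τ = 1`.
Consistent with the only published non-CM partial-weight-one examples (Moy–Specter: Steinberg at the INERT,
non-alignable, prime `2` of `ℚ(√5)`).  Why it might fail: it is the "automorphic contradiction (Galois
`N = 0` versus Steinberg) nobody has derived" of the crux — purity is unavailable for congruence-built `ρ`,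
and Newton's level-lowering/Kassaei gluing has no classicality theorem for Steinberg-at-`ℓ` partial weight
one; ONE partial-weight-one newform over a real quadratic field, Steinberg at a split prime carrying the
weight-one embedding, refutes it (the route's KILL CRITERION (1)).  Size XL (open).
[cite: Newton2015LowWeight, §1.1 and Thm. 1] [cite: MoySpecter2015, Rem. 1.1] [cite: JacquetLanglands1970, Thm. 3.3 (ii)]
[cite: TaylorGaloisRepresentations2004, Conj. 7 (ICM numbering)] -/
theorem stub_notSpecialAtAligned :
    ∀ (K : Type) [Field K] [NumberField K], NumberField.IsTotallyReal K → ∀ (hcpt : Literature.NumberTheory.Automorphic.isCompact_glFiniteIntegralLevel 2 K) (π : Literature.NumberTheory.Automorphic.CuspidalAutomorphicRepData 2 K hcpt) (k : (K →+* ℂ) → ℕ) (w : ℤ), π.1.IsLAlgebraic → π.1.HasInfinityType (fun β : K →+* ℂ => ({(⟨((k β : ℂ) - 1 - w) / 2, (1 - (k β : ℂ) - w) / 2, (k β : ℤ) - 1, by push_cast; ring⟩ : Literature.NumberTheory.Automorphic.ArchWeight), (⟨((k β : ℂ) - 1 - w) / 2, (1 - (k β : ℂ) - w) / 2, (k β :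 ℤ) - 1, by push_cast; ring⟩ : Literature.NumberTheory.Automorphic.ArchWeight).swap} : Multiset Literature.NumberTheory.Automorphic.ArchWeight)) → (∀ (u : NumberField.InfinitePlace K), ∀ φ ∈ π.1.W, Literature.NumberTheory.Automorphic.rightTranslation (Literature.NumberTheory.Automorphic.AdelicGroupData.gl 2 K) (Matrix.GeneralLinearGroup.scalar (Fin 2) (Units.map (MonoidHom.inl (NumberField.InfiniteAdeleRing K) (IsDedekindDomain.FiniteAdeleRing (NumberField.RingOfIntegers K) K) : NumberField.InfiniteAdeleRing K →* NumberField.AdeleRing (NumberField.RingOfIntegers K) K) (Units.map (MonoidHom.mulSingle (fun u' : NumberField.InfinitePlace K => u'.Completion) u : u.Completion →* NumberField.InfiniteAdeleRing K) (-1)))) φ + φ ∈ π.1.W') → (∃ β : K →+* ℂ, k β = 1) → ∀ (ℓ : ℕ) [Fact ℓ.Prime] (ι : PadicAlgCl ℓ ≃+* ℂ) (ρ : Literature.NumberTheory.GaloisRepresentations.FramedGaloisRep K (PadicAlgCl ℓ) 2), ρ.toGaloisRep.IsIrreducible → (∀ᶠ v : IsDedekindDomain.HeightOneSpectrum (NumberField.RingOfIntegers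 K) in Filter.cofinite, Summit.Langlands.SatakeFrobCompatibleAt ι π.1 ρ v) → ∀ (v : IsDedekindDomain.HeightOneSpectrum (NumberField.RingOfIntegers K)) (hv : ((ℓ : ℕ) : NumberField.RingOfIntegers K) ∈ v.asIdeal), (∀ τ : K →+* PadicAlgCl ℓ, (∀ x : NumberField.RingOfIntegers K, x ∈ v.asIdeal → ‖τ x‖ < 1) → k ((ι : PadicAlgCl ℓ →+* ℂ).comp τ) = 1) → (∀ 𝔓 ∈ v.primesAbove, ∃ S : Finset (GL (Fin 2) (PadicAlgCl ℓ)), ∀ σ ∈ 𝔓.inertia (Field.absoluteGaloisGroup K), ∃ g ∈ S, ∃ c : PadicAlgCl ℓ, ((ρ σ : GL (Fin 2) (PadicAlgCl ℓ)) : Matrix (Fin 2) (Fin 2) (PadicAlgCl ℓ)) = c • ((g : GL (Fin 2) (PadicAlgCl ℓ)) : Matrix (Fin 2) (Fin 2) (PadicAlgCl ℓ))) → ¬ π.1.IsSpecialAt v := by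
  sorry

/-- **STUB 4 — local–global compatibility at an aligned, non-special place, given de Rham (WD matching).**
In the FULL setting of the crux (`RD` serving the regular Hilbert case included), if moreover `ρ|Γ_{K_v}` is
de Rham for `RD.pst ℓ v hv` and `π` is not special at `v`, then `LocalGlobalCompatibleAt RD ι π ρ v`:
`ι WD(ρ|Γ_{K_v})^{F-ss} ≅ rec_v(π_v)`.  Content: `π_v` is a principal series or supercuspidal; on the Galois
side `ρ|Γ_L = χ ⊗ ρ_L` (`ρ_L` unramified) so `WD(ρ|Γ_{K_v}) = (σ, 0)` with `σ|_{I_v}` of finite image — one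
must match the inertial (Galois) type of `σ` with the type of `π_v` and the Frobenius eigenvalues with the
`U_v`-eigenvalues.  Why plausibly true: for `π_v` a REGULAR principal series it is Boxer–Pilloni Thm. 23 (4)
(potentially crystalline + compatibility, by Kisin's interpolation of crystalline periods on the eigenvariety,
conditional on Mok per their Rem. 24); in general, after a solvable totally real base change `K'/K` making
`π_v` an unramified principal series (types are killed by base change; supercuspidals of `GL₂` become
principal series over a suitable extension when `ℓ ≠ 2` or the supercuspidal is not exceptional), the
regular-PS case over `K'` plus Brauer induction / descent of the Weil–Deligne class along the solvable
layers gives the class over `K_v`; `RD` serving the regular case pins `rec_v` to Henniart's on generic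
classes.  Why it might fail: non-distinguished (irregular) principal series and `ℓ = 2` exceptional
supercuspidals have no eigenvariety handle; weight-one companion / critical points where Kisin's period
argument degenerates; the descent of the WD class through a non-Galois-invariant situation.  Size XL.
[cite: BoxerPilloni2021HigherColeman, Thm. 23 (4) and Rem. 24] [cite: Kisin2003, Thm. 6.3]
[cite: Skinner2009, Thm. 1] [cite: HarrisTaylorAMS2001, Thm. A] [cite: Newton2015LowWeight, Thm. 1] -/
theorem stub_lgcOfNotSpecialAligned :
    ∀ (K : Type) [Field K] [NumberField K], NumberField.IsTotallyReal K → ∀ (RD : Summit.Langlands.ReciprocityData K), (∀ (hcpt' : Literature.NumberTheory.Automorphic.isCompact_glFiniteIntegralLevel 2 K) (π' : Literature.NumberTheory.Automorphic.CuspidalAutomorphicRepData 2 K hcpt'), π'.1.IsLAlgebraic → (∃ T : Literature.NumberTheory.Automorphic.InfinityType K 2, π'.1.HasInfinityType T ∧ T.IsRegular) → ∀ (ℓ' : ℕ) [Fact ℓ'.Prime] (ι' : PadicAlgCl ℓ' ≃+* ℂ), ∃ ρ' : Literature.NumberTheory.GaloisRepresentations.FramedGaloisRep K (PadicAlgCl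 ℓ') 2, ρ'.toGaloisRep.IsIrreducible ∧ Summit.Langlands.IsGeometricFramed RD ρ' ∧ Summit.Langlands.Corresponds RD ι' π'.1 ρ') → ∀ (hcpt : Literature.NumberTheory.Automorphic.isCompact_glFiniteIntegralLevel 2 K) (π : Literature.NumberTheory.Automorphic.CuspidalAutomorphicRepData 2 K hcpt) (k : (K →+* ℂ) → ℕ) (w : ℤ), π.1.IsLAlgebraic → π.1.HasInfinityType (fun β : K →+* ℂ => ({(⟨((k β : ℂ) - 1 - w) / 2, (1 - (k β : ℂ) - w) / 2, (k β : ℤ) - 1, by push_cast; ring⟩ : Literature.NumberTheory.Automorphic.ArchWeight), (⟨((k β : ℂ) - 1 - w) / 2, (1 - (k β : ℂ) - w) / 2, (k β : ℤ) - 1, by push_cast; ring⟩ : Literature.NumberTheory.Automorphic.ArchWeight).swap} : Multiset Literature.NumberTheory.Automorphic.ArchWeight)) → (∀ (u : NumberField.InfinitePlace K), ∀ φ ∈ π.1.W, Literature.NumberTheory.Automorphic.rightTranslation (Literature.NumberTheory.Automorphic.AdelicGroupData.gl 2 K) (Matrix.GeneralLinearGroup.scalar (Fin 2) (Units.map (MonoidHom.inl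 (NumberField.InfiniteAdeleRing K) (IsDedekindDomain.FiniteAdeleRing (NumberField.RingOfIntegers K) K) : NumberField.InfiniteAdeleRing K →* NumberField.AdeleRing (NumberField.RingOfIntegers K) K) (Units.map (MonoidHom.mulSingle (fun u' : NumberField.InfinitePlace K => u'.Completion) u : u.Completion →* NumberField.InfiniteAdeleRing K) (-1)))) φ + φ ∈ π.1.W') → (∃ β : K →+* ℂ, k β = 1) → ∀ (ℓ : ℕ) [Fact ℓ.Prime] (ι : PadicAlgCl ℓ ≃+* ℂ) (ρ : Literature.NumberTheory.GaloisRepresentations.FramedGaloisRep K (PadicAlgCl ℓ) 2), ρ.toGaloisRep.IsIrreducible → (∀ᶠ v : IsDedekindDomain.HeightOneSpectrum (NumberField.RingOfIntegers K) in Filter.cofinite, Summit.Langlands.SatakeFrobCompatibleAt ι π.1 ρ v) → ∀ (v : IsDedekindDomain.HeightOneSpectrum (NumberField.RingOfIntegers K)) (hv : ((ℓ : ℕ) : NumberField.RingOfIntegers K) ∈ v.asIdeal), (∀ τ : K →+* PadicAlgCl ℓ, (∀ x : NumberField.RingOfIntegers K, x ∈ v.asIdeal → ‖τ x‖ < 1)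 → k ((ι : PadicAlgCl ℓ →+* ℂ).comp τ) = 1) → (∀ 𝔓 ∈ v.primesAbove, ∃ S : Finset (GL (Fin 2) (PadicAlgCl ℓ)), ∀ σ ∈ 𝔓.inertia (Field.absoluteGaloisGroup K), ∃ g ∈ S, ∃ c : PadicAlgCl ℓ, ((ρ σ : GL (Fin 2) (PadicAlgCl ℓ)) : Matrix (Fin 2) (Fin 2) (PadicAlgCl ℓ)) = c • ((g : GL (Fin 2) (PadicAlgCl ℓ)) : Matrix (Fin 2) (Fin 2) (PadicAlgCl ℓ))) → (RD.pst ℓ v hv).IsDeRhamFramed (ρ.toLocal v) → ¬ π.1.IsSpecialAt v → Summit.Langlands.LocalGlobalCompatibleAt RD ι π.1 ρ v := by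
  sorry

/-! ## 2. The stub statements as named `Prop`s (literally their types) -/

namespace _Goal

/-- The statement of `stub_hodgeTateAtAligned`, as a named `Prop` (literally its type). [folklore] -/
def stub_hodgeTateAtAligned : Prop :=
  type_of% @Summit.Langlands.Langlands.Cruxes.AlignedAtEll.Birth.stub_hodgeTateAtAligned

/-- The statement of `stub_deRhamOfProjFiniteHodgeTate`, as a named `Prop` (literally its type). [folklore] -/
def stub_deRhamOfProjFiniteHodgeTate : Prop :=
  type_of% @Summit.Langlands.Langlands.Cruxes.AlignedAtEll.Birth.stub_deRhamOfProjFiniteHodgeTate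

/-- The statement of `stub_notSpecialAtAligned`, as a named `Prop` (literally its type). [folklore] -/
def stub_notSpecialAtAligned : Prop :=
  type_of% @Summit.Langlands.Langlands.Cruxes.AlignedAtEll.Birth.stub_notSpecialAtAligned

/-- The statement of `stub_lgcOfNotSpecialAligned`, as a named `Prop` (literally its type). [folklore] -/
def stub_lgcOfNotSpecialAligned : Prop :=
  type_of% @Summit.Langlands.Langlands.Cruxes.AlignedAtEll.Birth.stub_lgcOfNotSpecialAligned

end _Goal

/-! ## 3. The composition (kernel-checked, no `sorry`): HT → de Rham; not special → WD matching; the crux by name -/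

/-- **`AlignedAtEll` from the four stubs.**  Fix the crux's context.  Stub 1 gives Hodge–Tate at every
`(v, τ)`; with the crux's projective-finiteness hypothesis, stub 2 (at `n = 2`) gives de Rham at `v` for
Fontaine's pinned datum, which IS `RD.pst ℓ v hv` by definition (`Summit.Langlands.ReciprocityData.pst`);
stub 3 gives `¬ π.1.IsSpecialAt v`; stub 4 turns de Rham + non-speciality into `LocalGlobalCompatibleAt`.
The hypotheses are, by name, the statements of the four stubs; the conclusion is the route decl
`Summit.Langlands.Langlands.Theses.SenNullAlignment.AlignedAtEll`. [folklore] -/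
theorem AlignedAtEll_of (h1 : _Goal.stub_hodgeTateAtAligned) (h2 : _Goal.stub_deRhamOfProjFiniteHodgeTate)
    (h3 : _Goal.stub_notSpecialAtAligned) (h4 : _Goal.stub_lgcOfNotSpecialAligned) :
    Summit.Langlands.Langlands.Theses.SenNullAlignment.AlignedAtEll := by
  -- the stub statements, as the Π-types they literally are
  have h1' : type_of% @stub_hodgeTateAtAligned := h1
  have h2' : type_of% @stub_deRhamOfProjFiniteHodgeTate := h2
  have h3' : type_of% @stub_notSpecialAtAligned := h3
  have h4' : type_of% @stub_lgcOfNotSpecialAligned := h4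
  intro K _ _ hK RD hreg hcpt π k w hL hhol hodd hne ℓ _ ι ρ hirr hae v hv hal hfin
  -- Galois half: Hodge–Tate at every (v, τ) (stub 1), hence de Rham at v (stub 2 at n = 2)
  have hHT := h1' K hK hcpt π k w hL hhol hodd hne ℓ ι ρ hirr hae v hv hal hfin
  have hdR : (RD.pst ℓ v hv).IsDeRhamFramed (ρ.toLocal v) := h2' K 2 ℓ ρ v hv hfin hHT
  -- automorphic half: π is not special at v (stub 3), hence WD matching at v (stub 4)
  have hns := h3' K hK hcpt π k w hL hhol hodd hne ℓ ι ρ hirr hae v hv hal hfin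
  exact ⟨h4' K hK RD hreg hcpt π k w hL hhol hodd hne ℓ ι ρ hirr hae v hv hal hfin hdR hns, hdR⟩

/-- By-name sanity check (an `example`, not a declaration of the file): the four stubs feed the
composition as they stand. -/
example : Summit.Langlands.Langlands.Theses.SenNullAlignment.AlignedAtEll :=
  AlignedAtEll_of stub_hodgeTateAtAligned stub_deRhamOfProjFiniteHodgeTate stub_notSpecialAtAligned
    stub_lgcOfNotSpecialAligned

end Summit.Langlands.Langlands.Cruxes.AlignedAtEll.Birth

end
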